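import Summits.ResolutionOfSingularities.ResolutionOfSingularities.Theorems.RadicialJungCleanModelsCcurveRegResidue
import HarnessLib

/-!
# Route `RadicialJung`, crux `CleanModels` (stmt-15917) — (C-curve) sub-line over ARBITRARY ground fields, brick 1: the dichotomy at a best `p`-th-power
# approximation in a valued field

Lead `res-B-lead-1` g7 (towards Sketch rev 30: the unit case `persistForm2` without `PerfectField k`).  OURS · counted 0.  Nothing here proves resolution in
characteristic `p`; resolution in char `p` is NOT proved.

`dichotomy_of_best_approx`: in a valued field `(L, W)` of characteristic `p`, if `f₀` is a BEST `p`-th-power approximation of `w` (`W.val (w − f₀^p) ≤ W.val (w − f^p)`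
for all `f`) and `w − f₀^p = z^m · U` with `U` a `W`-unit and `z ≠ 0`, then EITHER `p ∤ m` OR the residue of `U` is not a `p`-th power
(`W.val (U − e^p) = 1` for every `e ∈ W`): otherwise `f₀ + z^{m/p} e` would be a better approximation.  This is the closed-point reading of «ramified or inert»
for the purely inseparable extension `L(w^{1/p})`; with ✓ `exists_isMin_pthPowerApprox_of_isDefectlessField` (Kuhlmann) it replaces the `p`-degree argument of
✓ `Ccurve.exists_sub_pow_eq_of_form2`, which needs a perfect ground field.
-/

noncomputable section

set_option linter.dupNamespace false

open IsLocalRing Literature.AlgebraicGeometry.Resolution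

namespace Summit.ResolutionOfSingularities.ResolutionOfSingularities.Theorems.RadicialJung.CleanModels.Ccurve

/-- **Dichotomy at a best `p`-th-power approximation** — see the module docstring. [folklore] -/
theorem dichotomy_of_best_approx {L : Type} [Field L] (p : ℕ) [hp : Fact p.Prime] [CharP L p] (W : ValuationSubring L)
    {w f₀ z U : L} (hz0 : z ≠ 0) (hUW : U ∈ W) (hU : W.valuation U = 1) {m : ℕ}
    (hδ : w - f₀ ^ p = z ^ m * U)
    (hbest : ∀ f : L, W.valuation (w - f₀ ^ p) ≤ W.valuation (w - f ^ p)) :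
    ¬ p ∣ m ∨ ∀ e ∈ W, W.valuation (U - e ^ p) = 1 := by
  by_cases hpm : p ∣ m
  · right
    intro e he
    by_contra hne
    have hle : W.valuation (U - e ^ p) ≤ 1 := (W.valuation_le_one_iff _).mpr (sub_mem hUW (pow_mem he _))
    have hlt : W.valuation (U - e ^ p) < 1 := lt_of_le_of_ne hle hne
    obtain ⟨j, rfl⟩ := hpm
    -- the better approximation `f₁ = f₀ + z^j e`
    have hcalc : w - (f₀ + z ^ j * e) ^ p = z ^ (p * j) * (U - e ^ p) := by
      rw [add_pow_char, mul_pow, ← pow_mul, mul_comm j p]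
      linear_combination hδ
    have hzp : 0 < W.valuation (z ^ (p * j)) := by
      rw [map_pow]; exact pow_pos ((Valuation.pos_iff _).mpr hz0) _
    have hbad : W.valuation (w - (f₀ + z ^ j * e) ^ p) < W.valuation (w - f₀ ^ p) := by
      rw [hcalc, hδ, map_mul, map_mul, hU, mul_one]
      calc W.valuation (z ^ (p * j)) * W.valuation (U - e ^ p) < W.valuation (z ^ (p * j)) * 1 :=
            mul_lt_mul_of_pos_left hlt hzp
        _ = W.valuation (z ^ (p * j)) := mul_one _
    exact not_le.mpr hbad (hbest _)
  · exact Or.inl hpm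

/-- A best approximation from a valuation ring lies in the ring when the target does: if `w ∈ W` and `f₀` is a best `p`-th-power approximation of `w`, then
`f₀ ∈ W`. [folklore] -/
theorem best_approx_mem {L : Type} [Field L] (p : ℕ) [hp : Fact p.Prime] (W : ValuationSubring L) {w f₀ : L} (hw : w ∈ W)
    (hbest : ∀ f : L, W.valuation (w - f₀ ^ p) ≤ W.valuation (w - f ^ p)) : f₀ ∈ W := by
  by_contra hf₀
  have h0 := hbest 0
  rw [zero_pow hp.out.ne_zero, sub_zero] at h0
  have hw1 : W.valuation w ≤ 1 := (W.valuation_le_one_iff _).mpr hw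
  have hf1 : 1 < W.valuation f₀ := by
    rw [← not_le, W.valuation_le_one_iff]; exact hf₀
  have hfp : 1 < W.valuation (f₀ ^ p) := by
    rw [map_pow]; exact one_lt_pow₀ hf1 hp.out.ne_zero
  have hlt : W.valuation w < W.valuation (f₀ ^ p) := lt_of_le_of_lt hw1 hfp
  have heq : W.valuation (w - f₀ ^ p) = W.valuation (f₀ ^ p) := by
    rw [sub_eq_add_neg, Valuation.map_add_eq_of_lt_right _ (by rw [Valuation.map_neg]; exact hlt), Valuation.map_neg]
  rw [heq] at h0
  exact not_lt.mpr h0 hlt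

end Summit.ResolutionOfSingularities.ResolutionOfSingularities.Theorems.RadicialJung.CleanModels.Ccurve

end
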